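import Summits.PneNP.PneNP.Theorems.PeaTwoMemBPP.Negative.SparseQuadraticGadget

/-!
# PneNP / SzkEntropy — crux `PeaTwoMemBPP` (stmt-PneNP-10778), negative side, support: fibre counting for the gadget test maps

Route `PneNP/SzkEntropy`, crux stmt-PneNP-10778.  First of five support files for `GadgetReduction.lean`, the
entropy side (THEOREM 10.1 of the crux's `Disproof.lean` §10) of the machine-checked theorem
**no entropy-exact local quadratic gadget replaces a cubic monomial** (`no_entropy_exact_quadratic_gadget`).

Generic setting: a finite "variable space" `G`, a gadget `A : G → F₂` (the replacement of the cubic monomial),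
`B : G → β` (the appended outputs), a slice map `π : G → X` (application: `π = ξ`, the monomial's variables) and
a form `lam : G → F₂` (application: a coordinate `ξ_l`).  The gadget-side test maps of `Disproof.lean` §10 are
`q1 (y, z) = (A y + z, B y)`, `q4 (y, z) = (A y + z, π y, B y)`, `q3 y = (A y, π y, B y)`, `q2 y = (A y, B y)`,
`q5 (y, z) = (A y + lam y · z, B y)` (`z` a fresh uniform bit).  This file identifies their fibres with the cells
`V b = {B = b}`, `Vx b x`, `Va b a`, `Vxa b x a` and expresses their fibre products `FP(f) = ∏_v |f⁻¹(f v)|` —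
the datum of the Shannon entropy (`mapEntropy_univ_eq_logb`: `H(f(U)) = log₂|ι| − log₂FP(f)/|ι|`) — through
them.  No real analysis beyond that bridge.

References: Z. Dvir, D. Gutfreund, G. N. Rothblum, S. Vadhan, *On approximating the entropy of polynomial
mappings*, ICS 2011, §2–3; T. Cover, J. Thomas, *Elements of Information Theory*, 2nd ed., §2.1.
-/

namespace Summit.PneNP.PneNP.Theorems.PeaTwoMemBPP.Negative

open Finset Literature.InformationTheory.Entropy

/-! ### Fibre products and the entropy bridge -/

section FP

variable {ι β : Type*} [Fintype ι] [DecidableEq β]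

/-- The fibre product `FP(f) = ∏_v |f⁻¹(f v)|` of a map on a finite type (so `H(f(U)) = log₂|ι| − log₂ FP(f)/|ι|`).
[DvirGutfreundRothblumVadhan2010, §2] -/
def fibProd (f : ι → β) : ℕ := ∏ v, (fiber Finset.univ f (f v)).card

/-- Fibre products are positive. [folklore] -/
theorem fibProd_pos (f : ι → β) : 0 < fibProd f :=
  Finset.prod_pos fun v _ => card_fiber_pos f (Finset.mem_univ v)

/-- **Entropy bridge**: `H(f(U_ι)) = log₂|ι| − log₂ FP(f) / |ι|`. [CoverThomas2006, §2.1] -/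
theorem mapEntropy_univ_eq_logb [Nonempty ι] (f : ι → β) :
    mapEntropy Finset.univ f = Real.logb 2 (Fintype.card ι) - Real.logb 2 (fibProd f) / Fintype.card ι := by
  rw [mapEntropy_eq_logb_sub Finset.univ_nonempty f, Finset.card_univ, fibProd]
  push_cast
  rfl

/-- The fibre of `f` over `f v` inside `univ` is the filter `{w | f w = f v}`. [folklore] -/
theorem fiber_univ_eq (f : ι → β) (v : ι) :
    fiber Finset.univ f (f v) = Finset.univ.filter fun w => f w = f v := rfl

end FP

/-! ### The cells of a gadget -/

section Cells

variable {G X β : Type*} [Fintype G] [DecidableEq X] [DecidableEq β]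
variable (A : G → ZMod 2) (B : G → β) (π : G → X)

/-- `V b = {y : B y = b}`. -/
def cellV (b : β) : Finset G := univ.filter fun y => B y = b
/-- `Vx b x = {y : B y = b, π y = x}`. -/
def cellVx (b : β) (x : X) : Finset G := univ.filter fun y => B y = b ∧ π y = x
/-- `Va b a = {y : B y = b, A y = a}`. -/
def cellVa (b : β) (a : ZMod 2) : Finset G := univ.filter fun y => B y = b ∧ A y = a
/-- `Vxa b x a = {y : B y = b, π y = x, A y = a}`. -/
def cellVxa (b : β) (x : X) (a : ZMod 2) : Finset G := univ.filter fun y => B y = b ∧ π y = x ∧ A y = a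

/-- The gadget test map `q1 (y, z) = (A y + z, B y)`. -/
def q1 : G × ZMod 2 → ZMod 2 × β := fun p => (A p.1 + p.2, B p.1)
/-- The gadget test map `q4 (y, z) = (A y + z, π y, B y)`. -/
def q4 : G × ZMod 2 → ZMod 2 × X × β := fun p => (A p.1 + p.2, π p.1, B p.1)
/-- The gadget test map `q3 y = (A y, π y, B y)`. -/
def q3 : G → ZMod 2 × X × β := fun y => (A y, π y, B y)
/-- The gadget test map `q2 y = (A y, B y)`. -/
def q2 : G → ZMod 2 × β := fun y => (A y, B y)
/-- The gadget test map `q5 (y, z) = (A y + lam y · z, B y)`. -/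
def q5 (lam : G → ZMod 2) : G × ZMod 2 → ZMod 2 × β := fun p => (A p.1 + lam p.1 * p.2, B p.1)

/-- `univ : Finset (ZMod 2) = {0, 1}`. [folklore] -/
theorem univ_zmod2 : (Finset.univ : Finset (ZMod 2)) = {0, 1} := by decide

/-- A product over `ZMod 2` has two factors. [folklore] -/
theorem prod_zmod2 {M : Type*} [CommMonoid M] (f : ZMod 2 → M) : ∏ z : ZMod 2, f z = f 0 * f 1 := by
  rw [univ_zmod2, Finset.prod_pair (by decide)]

/-- A sum over `ZMod 2` has two terms. [folklore] -/
theorem sum_zmod2 {M : Type*} [AddCommMonoid M] (f : ZMod 2 → M) : ∑ z : ZMod 2, f z = f 0 + f 1 := by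
  rw [univ_zmod2, Finset.sum_pair (by decide)]

/-- Counting pairs `(y', z')` by summing over `y'`. [folklore] -/
theorem card_filter_prod_eq_sum (P : G × ZMod 2 → Prop) [DecidablePred P] :
    ((Finset.univ : Finset (G × ZMod 2)).filter P).card =
      ∑ y, ((Finset.univ : Finset (ZMod 2)).filter fun z => P (y, z)).card := by
  classical
  rw [Finset.card_filter, ← Finset.univ_product_univ, Finset.sum_product]
  refine Finset.sum_congr rfl fun y _ => ?_
  rw [Finset.card_filter]

/-- For fixed `a v : F₂`, exactly one `z` solves `a + z = v`. [folklore] -/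
theorem card_filter_add_eq (a v : ZMod 2) :
    ((Finset.univ : Finset (ZMod 2)).filter fun z => a + z = v).card = 1 := by
  revert a v; decide

/-- **Fibres of `q1`**: `|q1⁻¹(q1(y,z))| = |V (B y)|`. [folklore] -/
theorem card_fiber_q1 (y : G) (z : ZMod 2) :
    (fiber Finset.univ (q1 A B) (q1 A B (y, z))).card = (cellV B (B y)).card := by
  rw [fiber_univ_eq]
  have : (Finset.univ.filter fun w : G × ZMod 2 => q1 A B w = q1 A B (y, z)) =
      Finset.univ.filter fun p : G × ZMod 2 => B p.1 = B y ∧ A p.1 + p.2 = A y + z := by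
    ext p
    simp only [q1, Finset.mem_filter, Finset.mem_univ, true_and, Prod.mk.injEq]
    tauto
  rw [this, card_filter_prod_eq_sum, cellV, Finset.card_filter]
  refine Finset.sum_congr rfl fun y' _ => ?_
  simp only
  by_cases hb : B y' = B y
  · rw [if_pos hb]
    have : (Finset.univ.filter fun z' : ZMod 2 => B y' = B y ∧ A y' + z' = A y + z) =
        Finset.univ.filter fun z' : ZMod 2 => A y' + z' = A y + z := by
      ext z'; simp [hb]
    rw [this, card_filter_add_eq]
  · rw [if_neg hb]
    have : (Finset.univ.filter fun z' : ZMod 2 => B y' = B y ∧ A y' + z' = A y + z) = ∅ := by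
      ext z'; simp [hb]
    rw [this, Finset.card_empty]

/-- **Fibres of `q4`**: `|q4⁻¹(q4(y,z))| = |Vx (B y) (π y)|`. [folklore] -/
theorem card_fiber_q4 (y : G) (z : ZMod 2) :
    (fiber Finset.univ (q4 A B π) (q4 A B π (y, z))).card = (cellVx B π (B y) (π y)).card := by
  rw [fiber_univ_eq]
  have : (Finset.univ.filter fun w : G × ZMod 2 => q4 A B π w = q4 A B π (y, z)) =
      Finset.univ.filter fun p : G × ZMod 2 => (B p.1 = B y ∧ π p.1 = π y) ∧ A p.1 + p.2 = A y + z := by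
    ext p
    simp only [q4, Finset.mem_filter, Finset.mem_univ, true_and, Prod.mk.injEq]
    tauto
  rw [this, card_filter_prod_eq_sum, cellVx, Finset.card_filter]
  refine Finset.sum_congr rfl fun y' _ => ?_
  simp only
  by_cases hb : B y' = B y ∧ π y' = π y
  · rw [if_pos hb]
    have : (Finset.univ.filter fun z' : ZMod 2 => (B y' = B y ∧ π y' = π y) ∧ A y' + z' = A y + z) =
        Finset.univ.filter fun z' : ZMod 2 => A y' + z' = A y + z := by
      ext z'; simp [hb]
    rw [this, card_filter_add_eq]
  · rw [if_neg hb]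
    have : (Finset.univ.filter fun z' : ZMod 2 => (B y' = B y ∧ π y' = π y) ∧ A y' + z' = A y + z) = ∅ := by
      ext z'; simp only [Finset.mem_filter, Finset.mem_univ, true_and, Finset.notMem_empty, iff_false]
      exact fun h => hb h.1
    rw [this, Finset.card_empty]

/-- **Fibres of `q3`**: `|q3⁻¹(q3 y)| = |Vxa (B y) (π y) (A y)|`. [folklore] -/
theorem card_fiber_q3 (y : G) :
    (fiber Finset.univ (q3 A B π) (q3 A B π y)).card = (cellVxa A B π (B y) (π y) (A y)).card := by
  rw [fiber_univ_eq, cellVxa]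
  congr 1
  ext y'
  simp only [q3, Finset.mem_filter, Finset.mem_univ, true_and, Prod.mk.injEq]
  tauto

/-- **Fibres of `q2`**: `|q2⁻¹(q2 y)| = |Va (B y) (A y)|`. [folklore] -/
theorem card_fiber_q2 (y : G) :
    (fiber Finset.univ (q2 A B) (q2 A B y)).card = (cellVa A B (B y) (A y)).card := by
  rw [fiber_univ_eq, cellVa]
  congr 1
  ext y'
  simp only [q2, Finset.mem_filter, Finset.mem_univ, true_and, Prod.mk.injEq]
  tauto

/-- The fibre count of `q5` over the cell `b` and value `v`:
`N(b, v) = Σ_{y' ∈ V b} #{z' : A y' + lam y' · z' = v}`. -/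
def countQ5 (lam : G → ZMod 2) (b : β) (v : ZMod 2) : ℕ :=
  ∑ y' ∈ cellV B b, ((Finset.univ : Finset (ZMod 2)).filter fun z' => A y' + lam y' * z' = v).card

/-- **Fibres of `q5`**: `|q5⁻¹(q5(y,z))| = N(B y, A y + lam y · z)`. [folklore] -/
theorem card_fiber_q5 (lam : G → ZMod 2) (y : G) (z : ZMod 2) :
    (fiber Finset.univ (q5 A B lam) (q5 A B lam (y, z))).card = countQ5 A B lam (B y) (A y + lam y * z) := by
  rw [fiber_univ_eq]
  have : (Finset.univ.filter fun w : G × ZMod 2 => q5 A B lam w = q5 A B lam (y, z)) =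
      Finset.univ.filter fun p : G × ZMod 2 => B p.1 = B y ∧ A p.1 + lam p.1 * p.2 = A y + lam y * z := by
    ext p
    simp only [q5, Finset.mem_filter, Finset.mem_univ, true_and, Prod.mk.injEq]
    tauto
  rw [this, card_filter_prod_eq_sum, countQ5, cellV, Finset.sum_filter]
  refine Finset.sum_congr rfl fun y' _ => ?_
  simp only
  by_cases hb : B y' = B y
  · rw [if_pos hb]
    congr 1
    ext z'; simp [hb]
  · rw [if_neg hb]
    have : (Finset.univ.filter fun z' : ZMod 2 => B y' = B y ∧ A y' + lam y' * z' = A y + lam y * z) = ∅ := by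
      ext z'; simp [hb]
    rw [this, Finset.card_empty]

/-! ### Fibre products of the five maps through the cells -/

/-- `FP(q1) = (∏_y |V (B y)|)²`. [folklore] -/
theorem fibProd_q1 : fibProd (q1 A B) = (∏ y, (cellV B (B y)).card) ^ 2 := by
  unfold fibProd
  rw [Fintype.prod_prod_type]
  simp only [card_fiber_q1, prod_zmod2]
  rw [sq, Finset.prod_mul_distrib]

/-- `FP(q4) = (∏_y |Vx (B y) (π y)|)²`. [folklore] -/
theorem fibProd_q4 : fibProd (q4 A B π) = (∏ y, (cellVx B π (B y) (π y)).card) ^ 2 := by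
  unfold fibProd
  rw [Fintype.prod_prod_type]
  simp only [card_fiber_q4, prod_zmod2]
  rw [sq, Finset.prod_mul_distrib]

/-- `FP(q3) = ∏_y |Vxa (B y) (π y) (A y)|`. [folklore] -/
theorem fibProd_q3 : fibProd (q3 A B π) = ∏ y, (cellVxa A B π (B y) (π y) (A y)).card := by
  unfold fibProd
  simp only [card_fiber_q3]

/-- `FP(q2) = ∏_y |Va (B y) (A y)|`. [folklore] -/
theorem fibProd_q2 : fibProd (q2 A B) = ∏ y, (cellVa A B (B y) (A y)).card := by
  unfold fibProd
  simp only [card_fiber_q2]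

/-- `FP(q5) = ∏_y N(B y, A y) · N(B y, A y + lam y)`. [folklore] -/
theorem fibProd_q5 (lam : G → ZMod 2) :
    fibProd (q5 A B lam) = ∏ y, countQ5 A B lam (B y) (A y) * countQ5 A B lam (B y) (A y + lam y) := by
  unfold fibProd
  rw [Fintype.prod_prod_type]
  simp only [card_fiber_q5, prod_zmod2, mul_zero, add_zero, mul_one]

/-! ### Elementary relations between the cells -/

/-- `Vx b x ⊆ V b`. [folklore] -/
theorem cellVx_subset (b : β) (x : X) : cellVx B π b x ⊆ cellV B b := by
  intro y hy
  simp only [cellVx, cellV, Finset.mem_filter, Finset.mem_univ, true_and] at hy ⊢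
  exact hy.1

/-- `Vxa b x a ⊆ Vx b x`. [folklore] -/
theorem cellVxa_subset (b : β) (x : X) (a : ZMod 2) : cellVxa A B π b x a ⊆ cellVx B π b x := by
  intro y hy
  simp only [cellVxa, cellVx, Finset.mem_filter, Finset.mem_univ, true_and] at hy ⊢
  exact ⟨hy.1, hy.2.1⟩

/-- `y` lies in its own cells. [folklore] -/
theorem mem_cellV_self (y : G) : y ∈ cellV B (B y) := by simp [cellV]
/-- `y` lies in its own cells. [folklore] -/
theorem mem_cellVx_self (y : G) : y ∈ cellVx B π (B y) (π y) := by simp [cellVx]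
/-- `y` lies in its own cells. [folklore] -/
theorem mem_cellVxa_self (y : G) : y ∈ cellVxa A B π (B y) (π y) (A y) := by simp [cellVxa]
/-- `y` lies in its own cells. [folklore] -/
theorem mem_cellVa_self (y : G) : y ∈ cellVa A B (B y) (A y) := by simp [cellVa]

/-- `Vxa b x a` is the `A = a` part of `Vx b x`. [folklore] -/
theorem cellVxa_eq_filter (b : β) (x : X) (a : ZMod 2) :
    cellVxa A B π b x a = (cellVx B π b x).filter fun y => A y = a := by
  ext y; simp [cellVxa, cellVx, and_assoc]

/-- `Vx b x` is the `π = x` part of `V b`. [folklore] -/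
theorem cellVx_eq_filter (b : β) (x : X) : cellVx B π b x = (cellV B b).filter fun y => π y = x := by
  ext y; simp [cellVx, cellV]

/-- `Va b a` is the `A = a` part of `V b`. [folklore] -/
theorem cellVa_eq_filter (b : β) (a : ZMod 2) : cellVa A B b a = (cellV B b).filter fun y => A y = a := by
  ext y; simp [cellVa, cellV]

/-- `|V b| = Σ_x |Vx b x|`. [folklore] -/
theorem card_cellV_eq_sum [Fintype X] (b : β) : (cellV B b).card = ∑ x, (cellVx B π b x).card := by
  rw [Finset.card_eq_sum_ones, ← Finset.sum_fiberwise (cellV B b) π (fun _ => 1)]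
  refine Finset.sum_congr rfl fun x _ => ?_
  rw [cellVx_eq_filter, Finset.card_eq_sum_ones]

/-- Regrouping a product over `G` by the value of `B`: `∏_y φ(B y, y) = ∏_b ∏_{y ∈ V b} φ(b, y)`
(over the `b` in the image). [folklore] -/
theorem prod_regroup_by_B [Fintype β] (φ : G → ℕ) :
    ∏ y, φ y = ∏ b, ∏ y ∈ cellV B b, φ y := by
  rw [← Finset.prod_fiberwise Finset.univ B φ]
  rfl

end Cells



end Summit.PneNP.PneNP.Theorems.PeaTwoMemBPP.Negative
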